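import Summits.NavierStokesRegularity.NavierStokesRegularity.Theorems.ScenarioCensusSteady
import Summits.NavierStokesRegularity.NavierStokesRegularity.Theorems.ScenarioCensusHelicalSlabLiouville
import HarnessLib

/-!
# Blow-up scenario census, block S: row S6 is EXCLUDED-IN-TREE (leaf closer)

Cell `pub/ns-census` (director-ns KEY req102, D-0154 (A)), typer seat `ns-census-typer-2` (generation 7).
Census row S6 (`ScenarioCensusSteady.lean`, Appendix 3: steady · HELICAL, pitch `κ ≠ 0` · BOUNDED
smooth steady Navier–Stokes flows on `ℝ³`, any `ν > 0`, no decay / Dirichlet hypothesis ⇒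
`U ≡ C e₃`; BY NAME the Literature fact `HanWangXie2023_helical_liouville` = Han–Wang–Xie,
arXiv:2312.10382 = Sci. China Math. 69 (2025), Thm 1.1) is closed BY NAME by the tree theorem
`ScenarioCensus.HelicalSlab.helical_liouville` (`ScenarioCensusHelicalSlabLiouville.lean`, with
its chain `…HelicalSlab{Tools,Flux,Pressure,PeriodicPressure,Energy,Radial,Terms}.lean` on top of
the S7d chain `…PeriodicSlab*`). This leaf file only composes the two (kept out of both so that
neither the row file nor the proof chain imports the other). The small period–Reynolds sub-cell
S6d (`PeriodicSlab.helical_liouville_small`) is subsumed. No summit statement is proved.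
-/

-- the summit and its single problem share the name (D-0017 nested layout)
set_option linter.dupNamespace false

noncomputable section

namespace Summit.NavierStokesRegularity.NavierStokesRegularity.Theorems.ScenarioCensus

/-- **Census row S6 is EXCLUDED-IN-TREE**: Han–Wang–Xie 2023, Thm 1.1 — for every `ν > 0` and
pitch `κ ≠ 0`, a bounded smooth helically symmetric steady Navier–Stokes flow on `ℝ³` is an axial
constant `C e₃`, with NO smallness of the period–Reynolds number — i.e. `Row_S6`
(`= Literature.Analysis.FluidPDE.HanWangXie2023_helical_liouville`, the named fact, now a theorem
of the tree), by `HelicalSlab.helical_liouville` (periodic pressure, the helical zero-flux of the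
radial velocity, Poincaré–Wirtinger on vertical periods, foot-point splitting of the pressure,
dyadic Saint-Venant). -/
theorem row_S6_excluded : Row_S6 :=
  fun _ν hν _κ hκ _U _P hUP hU hP hbdd hsym =>
    HelicalSlab.helical_liouville hν hκ hUP hU hP hbdd hsym

/-- The Literature fact `HanWangXie2023_helical_liouville` holds (same term; recorded under the
fact's own name for by-name citation — the fact itself lives in `Literature/` and cannot import
this Summits-side proof chain). -/
theorem hanWangXie2023_helical_liouville_holds :
    Literature.Analysis.FluidPDE.HanWangXie2023_helical_liouville :=
  row_S6_excluded

end Summit.NavierStokesRegularity.NavierStokesRegularity.Theorems.ScenarioCensus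

end
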